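import Summits.CriticalPhenomena.PercolationContinuityZ3.Theorems.PercNearOneGluingNoHeavyLowerTailSahiTransportJRTables

/-!
# `NoHeavyLowerTail` (crux stmt-CriticalPhenomena-4575), Sahi / Kahn positivity: the join–reduce certificate on `2^3` — evaluation

Support file (cell `prim-l12`, seat P3, gen 5; `--supports stmt-CriticalPhenomena-4575`).  Computational (`native_decide`, ≈ 4 s): for EVERY nontrivial
increasing pattern event `M` of `2^3` (`18` bitmasks) the join–reduce table passes `SahiTransportJR.checkJR 28 3 M` (integrality, structure, every capacity row,
all `210` transport rows over the `20` increasing bitmasks; degree-3 fibres as base-`2^28` digits).  With `…SahiTransportJRSound.transportCert_of_checkJR` this is ONE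
uniform certificate for every first slot on `≤ 3` coordinates (second proof of `…SahiJuntaSlotLeThree`). [this work]
-/

namespace Summit.CriticalPhenomena.PercolationContinuityZ3.Theorems.SahiTransportJR

/-- The nontrivial increasing pattern events of `2^3`. [this work] -/
def events3 : List ℕ := [128, 136, 160, 168, 170, 192, 200, 204, 224, 232, 234, 236, 238, 240, 248, 250, 252, 254]

/-- `events3` is `upsN 3` without the two trivial events. [this work] -/
theorem events3_eq : events3 = (SahiC3Cube.upsN 3).filter (fun M => !(M == 0) && !(M == 255)) := by native_decide

/-- The join–reduce certificate passes for every nontrivial increasing pattern event of `2^3`. [this work] -/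
theorem checkJR3_all : (events3.all fun M => checkJR 28 3 M) = true := by native_decide

/-- Pointwise form. [this work] -/
theorem checkJR3_of_mem {M : ℕ} (h : M ∈ events3) : checkJR 28 3 M = true := List.all_eq_true.1 checkJR3_all M h

end Summit.CriticalPhenomena.PercolationContinuityZ3.Theorems.SahiTransportJR
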